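import Mathlib
import Summits.AtomisticToContinuum.HydrodynamicLimit.Theorems.ImplosionDichotomyDenseExcursionCavityCentreRSystem
import Summits.AtomisticToContinuum.HydrodynamicLimit.Theorems.ImplosionDichotomyDenseExcursionCavityCentreRadial
import Summits.AtomisticToContinuum.HydrodynamicLimit.Theorems.ImplosionDichotomyDenseExcursionCavityTransport
import Summits.AtomisticToContinuum.HydrodynamicLimit.Theorems.ImplosionDichotomyDenseExcursionCavityCentreWronskian

/-!
# Existence of centre-regular solutions of the resolvent equation (theorem T3, existence half)
# (crux `DenseExcursion`, line `sonic-cavity-renewal`, brick for stub `stub_cavityResolventCk`)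

Helper file (`--supports stmt-AtomisticToContinuum-12586`, line lead a2, stub-worker E for `stub_cavityResolventCk`).
THEOREM T3 of the decomposition of `stub_cavityResolventCk`, EXISTENCE half (registered helper `centre_regular_branch`):
for a monatomic profile in the cavity tube, `Λ : ℂ` and `X > 0`,
(i) there is a REGULAR pair (`IsRegularPair`) solving the HOMOGENEOUS resolvent equation `Λŵ = linW`, `Λŝ = linS` on
`x ≤ −X` and non-trivial there; (ii) every regular source `(f, g)` has a regular particular solution of
`Λŵ − linW = f`, `Λŝ − linS = g` on `x ≤ −X`. Together with `centre_regular_unique` / `centre_regular_affine`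
(file `…CavityCentreUnique`): the regular solutions on `x ≤ −X` are exactly `particular + a·homogeneous`, `a ∈ ℂ`.

Construction (`centre_regular_solution`): the regular branch `(u, c)` in the signed radius (`centre_R_branch`: smooth
even on `(−δ, δ)`, `c(0) = c₀`, `ŵ = u(eˣ)`, `ŝ = e^{−x}c(eˣ)` solve for `eˣ < δ`) is symmetrised-extended to smooth even
functions on `ℝ` (`exists_contDiff_eq_on_Icc`), which gives a globally smooth pair solving on `x < log(δ/2)` whose
`ℝ³`-fields are smooth by `contDiff_radial_fields_of_even` — a REGULAR PAIR; it is continued to `x ≤ −X` by the regular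
transport (`exists_solution_segment`, uniqueness `eqOn_of_solutions` on the overlap), glued, cut off smoothly beyond
`−X/2`, and stays regular by `isRegularPair_of_eqOn`. Non-triviality for `c₀ = 1`: `ŝ(x) = e^{−x}c(eˣ) ≠ 0` far left.
Sources: folklore.
-/

noncomputable section

open Set Filter
open scoped Topology ContDiff

namespace Summit.AtomisticToContinuum.HydrodynamicLimit.Theorems.SonicCavityRenewal

open Summit.AtomisticToContinuum.HydrodynamicLimit.Theorems.R2OneModeTwoConditions
open Literature.MathematicalPhysics.KineticTheory (V3)

/-- EVEN SMOOTH EXTENSION: a function smooth on `(−δ, δ)` and even agrees on `[−δ/2, δ/2]` with a globally smooth EVEN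
function (symmetrise any smooth extension). [folklore] -/
theorem exists_even_contDiff_eq {u : ℝ → ℂ} {δ : ℝ} (hδ : 0 < δ) (hu : ContDiffOn ℝ ∞ u (Ioo (-δ) δ))
    (heven : ∀ R, u (-R) = u R) :
    ∃ v : ℝ → ℂ, ContDiff ℝ ∞ v ∧ (∀ R, v (-R) = v R) ∧ ∀ R, |R| ≤ δ / 2 → v R = u R := by
  obtain ⟨g, hg, hgu⟩ := exists_contDiff_eq_on_Icc (n := ⊤) (r := δ / 2) (by linarith) (by linarith) hu
  refine ⟨fun R => (g R + g (-R)) / 2, (hg.add (hg.comp contDiff_neg)).div_const 2, fun R => by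
    simp only [neg_neg]; ring, fun R hR => ?_⟩
  have h1 : R ∈ Icc (-(δ / 2)) (δ / 2) := ⟨by linarith [(abs_le.1 hR).1], (abs_le.1 hR).2⟩
  have h2 : -R ∈ Icc (-(δ / 2)) (δ / 2) := ⟨by linarith [(abs_le.1 hR).2], by linarith [(abs_le.1 hR).1]⟩
  simp only [hgu h1, hgu h2, heven R]
  ring

/-- The zero pair is a regular pair. [folklore] -/
theorem isRegularPair_zero : IsRegularPair (fun _ : ℝ => (0 : ℂ)) (fun _ : ℝ => (0 : ℂ)) :=
  ⟨contDiff_const, contDiff_const, fun _ => 0, fun _ => 0, fun _ => 0, fun _ => 0, contDiff_const, contDiff_const,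
    contDiff_const, contDiff_const, fun y _ => by simp⟩

/-- A CENTRE-REGULAR SOLUTION WITH PRESCRIBED `c(0)`: for a monatomic profile in the cavity tube, `Λ : ℂ`, `X > 0`, a
regular source `(f, g)` and `c₀ : ℂ` there is a regular pair solving `Λŵ − linW = f`, `Λŝ − linS = g` on `x ≤ −X`;
if `c₀ ≠ 0` then `ŝ ≠ 0` somewhere on `x ≤ −X` (see the module docstring). [folklore] -/
theorem centre_regular_solution {r : ℝ} {W S : ℝ → ℝ} (hP : IsMonatomicProfile r W S) (hT : CavityTube r W S) (Λ : ℂ)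
    {X : ℝ} (hX : 0 < X) {f g : ℝ → ℂ} (hfg : IsRegularPair f g) (c₀ : ℂ) :
    ∃ ŵ ŝ : ℝ → ℂ, IsRegularPair ŵ ŝ ∧
      (∀ x ∈ Iic (-X), Λ * ŵ x - linW r W S ŵ ŝ x = f x ∧ Λ * ŝ x - linS r W S ŵ ŝ x = g x) ∧
      (c₀ ≠ 0 → ∃ x ∈ Iic (-X), ŝ x ≠ 0) := by
  have hW : ContDiff ℝ ∞ W := hP.2.2.1
  have hS : ContDiff ℝ ∞ S := hP.2.2.2.1
  have hSpos : ∀ x, 0 < S x := hP.2.2.2.2.1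
  obtain ⟨-, hsup, -, -, -, -, -, hWenv, -⟩ := hT
  have hf : ContDiff ℝ ∞ f := hfg.1
  have hg : ContDiff ℝ ∞ g := hfg.2.1
  -- Step A: the regular branch in the signed radius, with `δ ≤ 2e^{−X}`
  obtain ⟨δ₁, hδ₁, hbr⟩ := centre_R_branch r W S hP Λ
  obtain ⟨u, c, hus, hcs, huce, hc0, hsol⟩ := hbr f g hfg c₀
  set δ : ℝ := min δ₁ (2 * Real.exp (-X)) with hδ
  have hδpos : 0 < δ := lt_min hδ₁ (by positivity)
  have hδδ₁ : δ ≤ δ₁ := min_le_left _ _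
  have hlogδ : Real.log (δ / 2) ≤ -X := by
    have h1 : δ / 2 ≤ Real.exp (-X) := by have := min_le_right δ₁ (2 * Real.exp (-X)); rw [hδ]; linarith
    calc Real.log (δ / 2) ≤ Real.log (Real.exp (-X)) := Real.log_le_log (by positivity) h1
      _ = -X := Real.log_exp _
  -- Step B: even smooth extensions `ũ, c̃` agreeing with `u, c` on `[−δ/2, δ/2]`
  have husδ : ContDiffOn ℝ ∞ u (Ioo (-δ) δ) := hus.mono (Ioo_subset_Ioo (by linarith) hδδ₁)
  have hcsδ : ContDiffOn ℝ ∞ c (Ioo (-δ) δ) := hcs.mono (Ioo_subset_Ioo (by linarith) hδδ₁)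
  obtain ⟨ut, hut, hute, hutu⟩ := exists_even_contDiff_eq hδpos husδ fun R => (huce R).1
  obtain ⟨ct, hct, hcte, hctc⟩ := exists_even_contDiff_eq hδpos hcsδ fun R => (huce R).2
  -- Step C: the globally smooth pair `ŵ₀ = ũ(eˣ)`, `ŝ₀ = e^{−x} c̃(eˣ)`, solving on `x < log(δ/2)`
  set ŵ₀ : ℝ → ℂ := fun y => ut (Real.exp y) with hŵ₀
  set ŝ₀ : ℝ → ℂ := fun y => (Real.exp (-y) : ℂ) * ct (Real.exp y) with hŝ₀
  have hŵ₀s : ContDiff ℝ ∞ ŵ₀ := hut.comp Real.contDiff_exp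
  have hŝ₀s : ContDiff ℝ ∞ ŝ₀ :=
    (Complex.ofRealCLM.contDiff.comp (Real.contDiff_exp.comp contDiff_neg)).mul (hct.comp Real.contDiff_exp)
  set L : ℝ := Real.log (δ / 2) with hL
  have hexpL : ∀ y, y < L → Real.exp y < δ / 2 := fun y hy => by
    calc Real.exp y < Real.exp L := Real.exp_lt_exp.2 hy
      _ = δ / 2 := by rw [hL, Real.exp_log (by positivity)]
  have hagreeW : EqOn ŵ₀ (fun y => u (Real.exp y)) (Iio L) := fun y hy => by
    simp only [hŵ₀]
    exact hutu _ (by rw [abs_of_pos (Real.exp_pos y)]; exact (hexpL y hy).le)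
  have hagreeS : EqOn ŝ₀ (fun y => (Real.exp (-y) : ℂ) * c (Real.exp y)) (Iio L) := fun y hy => by
    simp only [hŝ₀]
    rw [hctc _ (by rw [abs_of_pos (Real.exp_pos y)]; exact (hexpL y hy).le)]
  have hsol₀ : ∀ x, x < L → Λ * ŵ₀ x - linW r W S ŵ₀ ŝ₀ x = f x ∧ Λ * ŝ₀ x - linS r W S ŵ₀ ŝ₀ x = g x := by
    intro x hx
    have gw := hagreeW.eventuallyEq_of_mem (Iio_mem_nhds hx)
    have gs := hagreeS.eventuallyEq_of_mem (Iio_mem_nhds hx)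
    obtain ⟨h1, h2⟩ := lin_congr_of_eventuallyEq (r := r) (W := W) (S := S) gw gs
    rw [h1, h2, gw.eq_of_nhds, gs.eq_of_nhds]
    exact hsol x (lt_of_lt_of_le (by linarith [hexpL x hx]) hδδ₁)
  -- Step D: `(ŵ₀, ŝ₀)` is a regular pair
  have hreg₀ : IsRegularPair ŵ₀ ŝ₀ := by
    obtain ⟨hF₁, hF₂, -, -⟩ := contDiff_radial_fields_of_even hut hute
    obtain ⟨-, -, hG₁, hG₂⟩ := contDiff_radial_fields_of_even hct hcte
    refine ⟨hŵ₀s, hŝ₀s, fun y => (ut ‖y‖).re • y, fun y => (ut ‖y‖).im • y, fun y => (ct ‖y‖).re,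
      fun y => (ct ‖y‖).im, hF₁, hF₂, hG₁, hG₂, fun y hy => ?_⟩
    have hny : 0 < ‖y‖ := norm_pos_iff.2 hy
    have he : Real.exp (Real.log ‖y‖) = ‖y‖ := Real.exp_log hny
    have he' : (Real.exp (-Real.log ‖y‖) : ℂ) = ((‖y‖⁻¹ : ℝ) : ℂ) := by rw [Real.exp_neg, he]
    refine ⟨?_, ?_, ?_, ?_⟩
    · simp only [hŵ₀, he]
    · simp only [hŵ₀, he]
    · simp only [hŝ₀, he, he', Complex.re_ofReal_mul]; field_simp
    · simp only [hŝ₀, he, he', Complex.im_ofReal_mul]; field_simp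
  -- Step E: continuation to `[L − 1, −X/2]` and smooth cut-off beyond `−5X/8`
  set a : ℝ := L - 1 with ha
  set b : ℝ := -X / 2 with hb
  set x₀ : ℝ := L - 1 / 2 with hx₀
  have hLb : L < b := by rw [hb]; linarith
  have hab : a < b := by rw [ha]; linarith
  have hnc : ∀ x ∈ Icc a b, W x - 1 + S x ≠ 0 ∧ W x - 1 - S x ≠ 0 := by
    intro x hx
    have hx0 : x < 0 := by rw [hb] at hx; linarith [hx.2]
    have h1 := hsup x hx0
    have h2 := (abs_le.1 (hWenv x (by linarith)).1).2
    have h3 := hSpos x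
    exact ⟨(by linarith : 0 < W x - 1 + S x).ne', (by linarith : W x - 1 - S x < 0).ne⟩
  obtain ⟨ŵ₁, ŝ₁, hŵ₁s, hŝ₁s, hd₁, hŵ₁0, hŝ₁0, hsol₁⟩ :=
    exists_solution_segment (r := r) hW hS hab hnc Λ hf hg x₀ (ŵ₀ x₀) (ŝ₀ x₀)
  -- uniqueness on the overlap `(a, L)`
  have hx₀I : x₀ ∈ Ioo a L := ⟨by rw [hx₀, ha]; linarith, by rw [hx₀]; linarith⟩
  obtain ⟨heqw, heqs⟩ := eqOn_of_solutions (r := r) hW hS hx₀I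
    (fun x hx => hnc x ⟨hx.1.le, by linarith [hx.2]⟩) (Λ := Λ) (f := f) (g := g)
    (fun x _ => ⟨(hŵ₀s.differentiable (by simp)) x, (hŝ₀s.differentiable (by simp)) x⟩)
    (fun x _ => hd₁ x) (fun x hx => hsol₀ x hx.2) (fun x hx => hsol₁ x ⟨hx.1.le, by linarith [hx.2]⟩)
    hŵ₁0.symm hŝ₁0.symm
  -- the glued pair and the cut-off
  set ŵ₂ : ℝ → ℂ := fun x => if x ≤ x₀ then ŵ₀ x else ŵ₁ x with hŵ₂
  set ŝ₂ : ℝ → ℂ := fun x => if x ≤ x₀ then ŝ₀ x else ŝ₁ x with hŝ₂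
  have h2eq0 : EqOn ŵ₂ ŵ₀ (Iio L) ∧ EqOn ŝ₂ ŝ₀ (Iio L) := by
    constructor <;> intro x hx <;> by_cases h : x ≤ x₀
    · simp only [hŵ₂, if_pos h]
    · simp only [hŵ₂, if_neg h]; exact (heqw ⟨by rw [ha]; linarith [not_le.1 h, hx₀I.1], hx⟩).symm
    · simp only [hŝ₂, if_pos h]
    · simp only [hŝ₂, if_neg h]; exact (heqs ⟨by rw [ha]; linarith [not_le.1 h, hx₀I.1], hx⟩).symm
  have h2eq1 : EqOn ŵ₂ ŵ₁ (Ioo a b) ∧ EqOn ŝ₂ ŝ₁ (Ioo a b) := by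
    constructor <;> intro x hx <;> by_cases h : x ≤ x₀
    · simp only [hŵ₂, if_pos h]; exact heqw ⟨hx.1, lt_of_le_of_lt h hx₀I.2⟩
    · simp only [hŵ₂, if_neg h]
    · simp only [hŝ₂, if_pos h]; exact heqs ⟨hx.1, lt_of_le_of_lt h hx₀I.2⟩
    · simp only [hŝ₂, if_neg h]
  set a'' : ℝ := -(3 * X / 4) with ha''
  set b'' : ℝ := -(5 * X / 8) with hb''
  have hXa'' : -X < a'' := by rw [ha'']; linarith
  have hab'' : a'' < b'' := by rw [ha'', hb'']; linarith
  have hb''b : b'' < b := by rw [hb'', hb]; linarith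
  set ψ : ℝ → ℝ := fun x => Real.smoothTransition ((b'' - x) / (b'' - a'')) with hψ
  have hψs : ContDiff ℝ ∞ ψ := Real.smoothTransition.contDiff.comp (by rw [hψ] at *; fun_prop)
  have hψ1 : ∀ x, x ≤ a'' → ψ x = 1 := fun x hx =>
    Real.smoothTransition.one_of_one_le (by rw [le_div_iff₀ (by linarith)]; linarith)
  have hψ0 : ∀ x, b'' ≤ x → ψ x = 0 := fun x hx =>
    Real.smoothTransition.zero_of_nonpos (div_nonpos_of_nonpos_of_nonneg (by linarith) (by linarith))
  set ŵ : ℝ → ℂ := fun x => (ψ x : ℂ) * ŵ₂ x with hŵ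
  set ŝ : ℝ → ℂ := fun x => (ψ x : ℂ) * ŝ₂ x with hŝ
  -- local descriptions of `ŵ₂`
  have hloc0 : ∀ x, x < L → ŵ₂ =ᶠ[𝓝 x] ŵ₀ ∧ ŝ₂ =ᶠ[𝓝 x] ŝ₀ := fun x hx =>
    ⟨h2eq0.1.eventuallyEq_of_mem (Iio_mem_nhds hx), h2eq0.2.eventuallyEq_of_mem (Iio_mem_nhds hx)⟩
  have hloc1 : ∀ x ∈ Ioo a b, ŵ₂ =ᶠ[𝓝 x] ŵ₁ ∧ ŝ₂ =ᶠ[𝓝 x] ŝ₁ := fun x hx =>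
    ⟨h2eq1.1.eventuallyEq_of_mem (Ioo_mem_nhds hx.1 hx.2), h2eq1.2.eventuallyEq_of_mem (Ioo_mem_nhds hx.1 hx.2)⟩
  have hsmooth2 : ∀ x, x < b → ContDiffAt ℝ ∞ ŵ₂ x ∧ ContDiffAt ℝ ∞ ŝ₂ x := by
    intro x hx
    rcases lt_or_ge x L with hxL | hxL
    · obtain ⟨e1, e2⟩ := hloc0 x hxL
      exact ⟨hŵ₀s.contDiffAt.congr_of_eventuallyEq e1, hŝ₀s.contDiffAt.congr_of_eventuallyEq e2⟩
    · have hxI : x ∈ Ioo a b := ⟨by rw [ha]; linarith, hx⟩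
      obtain ⟨e1, e2⟩ := hloc1 x hxI
      exact ⟨(hŵ₁s.contDiffAt (Ioo_mem_nhds hxI.1 hxI.2)).congr_of_eventuallyEq e1,
        (hŝ₁s.contDiffAt (Ioo_mem_nhds hxI.1 hxI.2)).congr_of_eventuallyEq e2⟩
  have hsol2 : ∀ x, x < b → Λ * ŵ₂ x - linW r W S ŵ₂ ŝ₂ x = f x ∧ Λ * ŝ₂ x - linS r W S ŵ₂ ŝ₂ x = g x := by
    intro x hx
    rcases lt_or_ge x L with hxL | hxL
    · obtain ⟨e1, e2⟩ := hloc0 x hxL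
      obtain ⟨h1, h2⟩ := lin_congr_of_eventuallyEq (r := r) (W := W) (S := S) e1 e2
      rw [h1, h2, e1.eq_of_nhds, e2.eq_of_nhds]
      exact hsol₀ x hxL
    · have hxI : x ∈ Ioo a b := ⟨by rw [ha]; linarith, hx⟩
      obtain ⟨e1, e2⟩ := hloc1 x hxI
      obtain ⟨h1, h2⟩ := lin_congr_of_eventuallyEq (r := r) (W := W) (S := S) e1 e2
      rw [h1, h2, e1.eq_of_nhds, e2.eq_of_nhds]
      exact hsol₁ x (Ioo_subset_Icc_self hxI)
  -- smoothness of the cut-off pair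
  have hfar : ∀ x, b'' < x → ŵ =ᶠ[𝓝 x] (fun _ => 0) ∧ ŝ =ᶠ[𝓝 x] (fun _ => 0) := by
    intro x hx
    constructor <;> filter_upwards [Ioi_mem_nhds hx] with y hy <;>
      simp only [hŵ, hŝ, hψ0 y (le_of_lt hy), Complex.ofReal_zero, zero_mul]
  have hnear : ∀ x, x < a'' → ŵ =ᶠ[𝓝 x] ŵ₂ ∧ ŝ =ᶠ[𝓝 x] ŝ₂ := by
    intro x hx
    constructor <;> filter_upwards [Iio_mem_nhds hx] with y hy <;>
      simp only [hŵ, hŝ, hψ1 y (le_of_lt hy), Complex.ofReal_one, one_mul]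
  have hŵs : ContDiff ℝ ∞ ŵ := contDiff_iff_contDiffAt.2 fun x => by
    rcases lt_or_ge x b with hxb | hxb
    · exact ((Complex.ofRealCLM.contDiff.comp hψs).contDiffAt).mul (hsmooth2 x hxb).1
    · exact contDiffAt_const.congr_of_eventuallyEq (hfar x (by linarith)).1
  have hŝs : ContDiff ℝ ∞ ŝ := contDiff_iff_contDiffAt.2 fun x => by
    rcases lt_or_ge x b with hxb | hxb
    · exact ((Complex.ofRealCLM.contDiff.comp hψs).contDiffAt).mul (hsmooth2 x hxb).2
    · exact contDiffAt_const.congr_of_eventuallyEq (hfar x (by linarith)).2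
  -- agreement with the germ pair far left
  set m : ℝ := min x₀ a'' with hm
  have hagree : EqOn ŵ ŵ₀ (Iio m) ∧ EqOn ŝ ŝ₀ (Iio m) := by
    constructor <;> intro x hx
    · have hx1 : x < a'' := lt_of_lt_of_le hx (min_le_right _ _)
      have hx2 : x ≤ x₀ := (lt_of_lt_of_le hx (min_le_left _ _)).le
      simp only [hŵ, hŵ₂, hψ1 x hx1.le, if_pos hx2, Complex.ofReal_one, one_mul]
    · have hx1 : x < a'' := lt_of_lt_of_le hx (min_le_right _ _)
      have hx2 : x ≤ x₀ := (lt_of_lt_of_le hx (min_le_left _ _)).le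
      simp only [hŝ, hŝ₂, hψ1 x hx1.le, if_pos hx2, Complex.ofReal_one, one_mul]
  refine ⟨ŵ, ŝ, isRegularPair_of_eqOn ŵ₀ ŝ₀ ŵ ŝ m hreg₀ hŵs hŝs hagree.1 hagree.2, fun x hx => ?_, fun hc₀ => ?_⟩
  · -- the equations on `x ≤ -X < a''`
    have hxa : x < a'' := lt_of_le_of_lt hx hXa''
    obtain ⟨e1, e2⟩ := hnear x hxa
    obtain ⟨h1, h2⟩ := lin_congr_of_eventuallyEq (r := r) (W := W) (S := S) e1 e2
    rw [h1, h2, e1.eq_of_nhds, e2.eq_of_nhds]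
    exact hsol2 x (by linarith [hb''b])
  · -- non-triviality: `ŝ x = e^{-x} c(eˣ) ≠ 0` far left, since `c 0 = c₀ ≠ 0`
    have hccont : ContinuousAt c 0 :=
      (hcs.continuousOn.continuousWithinAt ⟨by linarith, hδ₁⟩).continuousAt (Ioo_mem_nhds (by linarith) hδ₁)
    have hev : ∀ᶠ R in 𝓝 (0 : ℝ), c R ≠ 0 := by
      have : {z : ℂ | z ≠ 0} ∈ 𝓝 (c 0) := isOpen_ne.mem_nhds (by rw [hc0]; exact hc₀)
      exact hccont.preimage_mem_nhds this
    obtain ⟨η, hη, hball⟩ := Metric.eventually_nhds_iff.1 hev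
    set x : ℝ := min (min (-X) (m - 1)) (Real.log η - 1) with hxdef
    have hx1 : x ≤ min (-X) (m - 1) := min_le_left _ _
    have hx2 : x ≤ Real.log η - 1 := min_le_right _ _
    have hxX : x ≤ -X := hx1.trans (min_le_left _ _)
    have hxm : x < m := by have := hx1.trans (min_le_right (-X) (m - 1)); linarith
    have hxL : x < L := lt_of_lt_of_le (lt_of_lt_of_le hxm (min_le_left _ _)) hx₀I.2.le
    have hxη : Real.exp x < η := by
      have h1 : x < Real.log η := by linarith
      calc Real.exp x < Real.exp (Real.log η) := Real.exp_lt_exp.2 h1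
        _ = η := Real.exp_log hη
    refine ⟨x, hxX, ?_⟩
    rw [hagree.2 hxm, hagreeS hxL]
    have hcx : c (Real.exp x) ≠ 0 := hball (by
      rw [Real.dist_eq, sub_zero, abs_of_pos (Real.exp_pos x)]; exact hxη)
    exact mul_ne_zero (Complex.ofReal_ne_zero.2 (Real.exp_pos _).ne') hcx

/-- **Registered helper `centre_regular_branch` (T3, existence half): EXISTENCE OF CENTRE-REGULAR HOMOGENEOUS AND
PARTICULAR SOLUTIONS OF THE RESOLVENT EQUATION ON `x ≤ −X`.** See the module docstring. [folklore] -/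
theorem centre_regular_branch : ∀ (r : ℝ) (W S : ℝ → ℝ), IsMonatomicProfile r W S → CavityTube r W S → ∀ (Λ : ℂ) (X : ℝ), 0 < X → (∃ ŵc ŝc : ℝ → ℂ, IsRegularPair ŵc ŝc ∧ (∀ x ∈ Set.Iic (-X), Λ * ŵc x = linW r W S ŵc ŝc x ∧ Λ * ŝc x = linS r W S ŵc ŝc x) ∧ ∃ x ∈ Set.Iic (-X), ŵc x ≠ 0 ∨ ŝc x ≠ 0) ∧ ∀ (f g : ℝ → ℂ), IsRegularPair f g → ∃ ŵp ŝp : ℝ → ℂ, IsRegularPair ŵp ŝp ∧ ∀ x ∈ Set.Iic (-X), Λ * ŵp x - linW r W S ŵp ŝp x = f x ∧ Λ * ŝp x - linS r W S ŵp ŝp x = g x := by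
  intro r W S hP hT Λ X hX
  constructor
  · obtain ⟨ŵc, ŝc, hreg, hsol, hne⟩ := centre_regular_solution hP hT Λ hX isRegularPair_zero 1
    refine ⟨ŵc, ŝc, hreg, fun x hx => ?_, ?_⟩
    · obtain ⟨h1, h2⟩ := hsol x hx
      exact ⟨sub_eq_zero.1 h1, sub_eq_zero.1 h2⟩
    · obtain ⟨x, hx, hsx⟩ := hne one_ne_zero
      exact ⟨x, hx, Or.inr hsx⟩
  · intro f g hfg
    obtain ⟨ŵp, ŝp, hreg, hsol, -⟩ := centre_regular_solution hP hT Λ hX hfg 0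
    exact ⟨ŵp, ŝp, hreg, hsol⟩

end Summit.AtomisticToContinuum.HydrodynamicLimit.Theorems.SonicCavityRenewal

end
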